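import Summits.BirchSwinnertonDyer.BirchSwinnertonDyer.Theorems.ShaPrimaryTransferIsoRowDoor
import Summits.BirchSwinnertonDyer.BirchSwinnertonDyer.Theorems.Rank2ObservatoryRank3IsoCensus
import HarnessLib

/-!
# BirchSwinnertonDyer / ShaPrimaryTransfer — crux `FiniteShaComponentTransfer` (stmt-BirchSwinnertonDyer-22356):
# THE KERNEL-ISO DOOR IN RANK `r`, and THE 966 RANK-3 CENSUS CURVES WITH ONE RATIONAL 2-TORSION POINT ARE DOORS AT 2 —
# `rank = 3 ∧ Ш[2] = 0 ∧ Ш[2^∞] = 0 ∧ t_2 = 0 ∧ corank_{ℤ₂} Sel_{2^∞} = 3`, unconditionally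

Route `ShaPrimaryTransfer` (D-0145 LINE 2): T = `FiniteShaComponentTransfer` (stmt-22356; conjecture-grade at corank `≥ 2`, UNCHANGED),
O = `OneFiniteShaComponent`. Helper file (prover seat `bsd-line-spt-p1` g34, `--supports stmt-22356`). BSD is NOT proved by any of this.

The rank-parametric KERNEL-ISO check `IsoRow.checkRank R r` (`Rank2ObservatoryRank3IsoTable`: Selmer supersets with
`log₂ #D₁ + log₂ #D₂ ≤ r + 2`, classes with `2^(r+1) < #cls₁ · #cls₂`) certifies `rank_ℤ E(ℚ) = r`; as in rank `2`
(`ShaPrimaryTransferIsoRowDoor`), the check says MORE: the descent via `2`-isogeny is SHARP (`dim₂ S + dim₂ S' ≤ rank + 2`), so by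
`XCubeAddDXSharpRankSha` §1 (Silverman X.4.7 with X.4.2(a)) `Ш(E)[φ] = Ш(E')[φ̂] = 0`, `Ш(E/ℚ)[2] = 0`:

* `IsoRow.door_of_checkRank` — `R.checkRank r = true ⇒ rank = r ∧ Ш(E/ℚ)[2] = 0 ∧ Ш(E/ℚ)[2^∞] = ⊥ ∧ t_2(E) = 0 ∧ corank Sel_{2^∞} = r`
  on the census model `E = R.curve`; `IsoRow.door_of_check3`, chunk form `IsoRow.door3_of_all`;
* **`rank3IsoRows_doors`** — applied to the rank-3 KERNEL-ISO table `rank3IsoRows` (`Rank2ObservatoryRank3IsoCensus`: ALL `966` curves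
  of the rank-3 census `rank3Table` — Cremona, conductor `< 5·10⁵` — with exactly one rational point of order `2`; every one has the sharp
  bound `#S^(φ)·#S^(φ̂) = 2⁵`): EVERY ONE is a door at `2` AT RANK 3 — `t_2(E) = 0`, `Ш(E/ℚ)[2^∞] = 0`, `corank Sel_{2^∞}(E/ℚ) = 3`,
  unconditionally (O at `p₀ = 2`; T's hypothesis armed at rank `3` on 966 census curves; T then predicts `t_q(E) = 0` at every `q`);
  `rank3IsoRows_doors_length` recalls the count `966`.

References: J. H. Silverman, *AEC* 2nd ed., Thm. X.4.2(a), Prop. X.4.7, X.4.9; J. H. Silverman, J. Tate, *Rational Points on Elliptic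
Curves* §3.6; J. E. Cremona, *Algorithms for Modular Elliptic Curves* (1997), Table 1; R. Greenberg, LNM 1716 (1999), §1.
-/

-- D-0017: single-problem summit, so `Summit.BirchSwinnertonDyer.BirchSwinnertonDyer.…` repeats a namespace BY DESIGN.
set_option linter.dupNamespace false

noncomputable section

namespace Summit.BirchSwinnertonDyer.BirchSwinnertonDyer.Rank2Observatory.IsoLocal.IsoRow

open scoped Classical
open Literature.NumberTheory.EllipticCurves WeierstrassCurve
open Summit.BirchSwinnertonDyer.BirchSwinnertonDyer.Rank2Observatory.IsoLocal

/-! ## §1 The door in rank `r` -/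

/-- The pieces of `R.checkRank r`: transport hypotheses, `b(a² − 4b) ≠ 0`, the two Selmer supersets and the count
`log₂ #D₁ + log₂ #D₂ ≤ r + 2`. [cite: SilvermanTate2015, §3.6] -/
theorem checkRank_parts (R : IsoRow) {r : ℕ} (h : R.checkRank r = true) :
    (R.scaled = true ∨ (R.a₁ = 0 ∧ R.a₃ = 0)) ∧
      R.e ^ 3 + R.A.1 * R.e ^ 2 + R.A.2.1 * R.e + R.A.2.2 = 0 ∧
      R.ab.2 * (R.ab.1 ^ 2 - 4 * R.ab.2) ≠ 0 ∧
      twoIsogenySelmerGroup R.ab.1 R.ab.2 ⊆ R.s₁.D.toFinset ∧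
      twoIsogenySelmerGroup (-2 * R.ab.1) (R.ab.1 ^ 2 - 4 * R.ab.2) ⊆ R.s₂.D.toFinset ∧
      Nat.log 2 R.s₁.D.toFinset.card + Nat.log 2 R.s₂.D.toFinset.card ≤ r + 2 := by
  simp only [checkRank, Bool.and_eq_true, Bool.or_eq_true, beq_iff_eq, bne_iff_ne, ne_eq,
    decide_eq_true_eq] at h
  obtain ⟨⟨⟨⟨⟨⟨hsc, he⟩, hab⟩, h₁⟩, h₂⟩, hcard⟩, -⟩ := h
  obtain ⟨hD₁, -⟩ := sideCheck_sound hab h₁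
  obtain ⟨hD₂, -⟩ := sideCheck_sound (twoIsogenyCodomain_ne_zero hab) h₂
  refine ⟨hsc, he, hab, hD₁, hD₂, ?_⟩
  rw [List.card_toFinset, List.card_toFinset]
  exact hcard

/-- **The descent of a rank-`r`-checked row is SHARP**: `dim₂ S(a,b) + dim₂ S'(a,b) ≤ rank E_{a,b}(ℚ) + 2`.
[cite: SilvermanAEC2009, Prop. X.4.7 and Thm. X.4.2(a)] [cite: SilvermanTate2015, §3.6] -/
theorem twoIsogenySelmerRank_add_le_of_checkRank (R : IsoRow) {r : ℕ} (h : R.checkRank r = true) :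
    twoIsogenySelmerRank R.ab.1 R.ab.2 + twoIsogenySelmerRank' R.ab.1 R.ab.2 ≤
      (⟨0, (R.ab.1 : ℚ), 0, (R.ab.2 : ℚ), 0⟩ : WeierstrassCurve ℚ).mordellWeilRank + 2 := by
  obtain ⟨hsc, he, hab, hD₁, hD₂, hcard⟩ := checkRank_parts R h
  have hr : (⟨0, (R.ab.1 : ℚ), 0, (R.ab.2 : ℚ), 0⟩ : WeierstrassCurve ℚ).mordellWeilRank = r := by
    obtain ⟨C, hC⟩ := exists_transport R hsc he
    have ht := mordellWeilRank_variableChange_holds R.curve C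
    rw [mordellWeilRank_variableChange, hC] at ht
    rw [ht]
    exact mordellWeilRank_eq_of_checkRank R h
  have e1 : twoIsogenySelmerRank R.ab.1 R.ab.2 ≤ Nat.log 2 R.s₁.D.toFinset.card :=
    Nat.log_mono_right (Finset.card_le_card hD₁)
  have e2 : twoIsogenySelmerRank' R.ab.1 R.ab.2 ≤ Nat.log 2 R.s₂.D.toFinset.card := by
    unfold twoIsogenySelmerRank' twoIsogenySelmerRank
    exact Nat.log_mono_right (Finset.card_le_card hD₂)
  omega

/-- The census model of a rank-`r`-checked row is an elliptic curve. [cite: SilvermanAEC2009, III.3.1(b)] -/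
theorem isElliptic_curve_of_checkRank (R : IsoRow) {r : ℕ} (h : R.checkRank r = true) : R.curve.IsElliptic := by
  obtain ⟨hsc, he, hab, -⟩ := checkRank_parts R h
  obtain ⟨C, hC⟩ := exists_transport R hsc he
  haveI := isElliptic_mk_of_ne_zero (F := ℚ) hab
  have hR : R.curve = C⁻¹ • (⟨0, (R.ab.1 : ℚ), 0, (R.ab.2 : ℚ), 0⟩ : WeierstrassCurve ℚ) := by
    rw [← hC, inv_smul_smul]
  rw [hR]
  infer_instance

/-- **THE KERNEL-ISO DOOR AT 2 IN RANK `r`.** For every `IsoRow` passing `IsoRow.checkRank r`, the census model `E = R.curve` has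
`rank_ℤ E(ℚ) = r`, `Ш(E/ℚ)[2] = 0`, `Ш(E/ℚ)[2^∞] = 0`, `t_2(E) = 0` and `corank_{ℤ₂} Sel_{2^∞}(E/ℚ) = r` — unconditionally.
[cite: SilvermanAEC2009, Prop. X.4.7 and Thm. X.4.2(a)] [cite: Greenberg1999LNM, §1 (pp. 54–57)] -/
theorem door_of_checkRank (R : IsoRow) {r : ℕ} (h : R.checkRank r = true) :
    haveI := isElliptic_curve_of_checkRank R h
    R.curve.mordellWeilRank = r ∧ (∀ c ∈ R.curve.sha, 2 • c = 0 → c = 0) ∧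
      AddCommGroup.primaryComponent R.curve.sha 2 = ⊥ ∧ R.curve.shaCorank 2 = 0 ∧ R.curve.selmerCorank 2 = r := by
  haveI := isElliptic_curve_of_checkRank R h
  haveI : Fact (Nat.Prime 2) := ⟨Nat.prime_two⟩
  obtain ⟨hsc, he, hab, -⟩ := checkRank_parts R h
  obtain ⟨C, hC⟩ := exists_transport R hsc he
  have hr := mordellWeilRank_eq_of_checkRank R h
  haveI := isElliptic_halfModel hab
  haveI := isElliptic_mk_of_ne_zero (F := ℚ) hab
  have hab' := forall_mem_sha_two_smul_eq_zero_of_selmerRank_add_le hab (twoIsogenySelmerRank_add_le_of_checkRank R h)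
  have hbot : AddSubgroup.torsionBy R.curve.sha ((2 : ℕ) : ℤ) = ⊥ :=
    sha_torsionBy_eq_bot_of_smul_eq hC 2 (sha_torsionBy_eq_bot_of_forall _ 2 hab')
  have hsha : ∀ c ∈ R.curve.sha, 2 • c = 0 → c = 0 := forall_of_sha_torsionBy_eq_bot R.curve 2 hbot
  have ht : R.curve.shaCorank 2 = 0 := shaCorank_eq_zero_of_forall _ 2 hsha
  refine ⟨hr, hsha, primaryComponent_sha_eq_bot_of_forall _ hsha, ht, ?_⟩
  rw [R.curve.selmerCorank_eq_mordellWeilRank_add_holds 2, hr, ht, add_zero]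

/-- Rank-`3` form: `R.check3 = true ⇒` the door at `2` at rank `3`. [cite: SilvermanAEC2009, Prop. X.4.7 and Thm. X.4.2(a)] -/
theorem door_of_check3 (R : IsoRow) (h : R.check3 = true) :
    haveI := isElliptic_curve_of_checkRank R h
    R.curve.mordellWeilRank = 3 ∧ (∀ c ∈ R.curve.sha, 2 • c = 0 → c = 0) ∧
      AddCommGroup.primaryComponent R.curve.sha 2 = ⊥ ∧ R.curve.shaCorank 2 = 0 ∧ R.curve.selmerCorank 2 = 3 :=
  door_of_checkRank R h

/-- Chunk form over `List.all IsoRow.check3` (the shape of the rank-3 data chunks' kernel theorems).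
[cite: SilvermanAEC2009, Prop. X.4.7 and Thm. X.4.2(a)] -/
theorem door3_of_all {rows : List IsoRow} (h : rows.all IsoRow.check3 = true) {R : IsoRow} (hR : R ∈ rows) :
    haveI := isElliptic_curve_of_checkRank R (List.all_eq_true.mp h R hR)
    R.curve.mordellWeilRank = 3 ∧ (∀ c ∈ R.curve.sha, 2 • c = 0 → c = 0) ∧
      AddCommGroup.primaryComponent R.curve.sha 2 = ⊥ ∧ R.curve.shaCorank 2 = 0 ∧ R.curve.selmerCorank 2 = 3 :=
  door_of_check3 R (List.all_eq_true.mp h R hR)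

end Summit.BirchSwinnertonDyer.BirchSwinnertonDyer.Rank2Observatory.IsoLocal.IsoRow

/-! ## §2 The 966 rank-3 census curves with one rational 2-torsion point -/

namespace Summit.BirchSwinnertonDyer.BirchSwinnertonDyer.Theorems.ShaPrimaryTransferIsoDoorsRank3

open scoped Classical
open Literature.NumberTheory.EllipticCurves WeierstrassCurve
open Summit.BirchSwinnertonDyer.BirchSwinnertonDyer.Rank2Observatory
open Summit.BirchSwinnertonDyer.BirchSwinnertonDyer.Rank2Observatory.IsoLocal

/-- **ALL 966 RANK-3 CENSUS CURVES WITH EXACTLY ONE RATIONAL POINT OF ORDER 2 ARE DOORS AT 2**: for every row `R` of the rank-3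
KERNEL-ISO table `rank3IsoRows`, on its census model `E = R.curve`: `rank_ℤ E(ℚ) = 3`, `Ш(E/ℚ)[2] = 0`, `Ш(E/ℚ)[2^∞] = 0`, `t_2(E) = 0`,
`corank_{ℤ₂} Sel_{2^∞}(E/ℚ) = 3` — unconditionally (O at `p₀ = 2`; T's hypothesis armed at rank `3`).
[cite: SilvermanAEC2009, Prop. X.4.7 and Thm. X.4.2(a)] [cite: CremonaAlgorithms1997, Tables] -/
theorem rank3IsoRows_doors : ∀ R ∈ rank3IsoRows, ∃ _h : R.curve.IsElliptic,
    R.curve.mordellWeilRank = 3 ∧ (∀ c ∈ R.curve.sha, 2 • c = 0 → c = 0) ∧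
      AddCommGroup.primaryComponent R.curve.sha 2 = ⊥ ∧ R.curve.shaCorank 2 = 0 ∧ R.curve.selmerCorank 2 = 3 :=
  fun R hR => ⟨IsoRow.isElliptic_curve_of_checkRank R (List.all_eq_true.mp rank3IsoRows_check R hR),
    IsoRow.door3_of_all rank3IsoRows_check hR⟩

/-- `t_2 = 0` alone, for every row of the rank-3 KERNEL-ISO table. [cite: Greenberg1999LNM, §1 (pp. 54–57)] -/
theorem rank3IsoRows_shaCorank_two : ∀ R ∈ rank3IsoRows, R.curve.shaCorank 2 = 0 :=
  fun _ hR => (IsoRow.door3_of_all rank3IsoRows_check hR).2.2.2.1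

/-- O for every row, in the route's `∃ p₀` shape (witness `p₀ = 2`). [cite: Greenberg1999LNM, §1 (pp. 54–57)] -/
theorem rank3IsoRows_exists_shaCorank_eq_zero : ∀ R ∈ rank3IsoRows, ∃ (p : ℕ) (_ : Fact p.Prime), R.curve.shaCorank p = 0 :=
  fun R hR => ⟨2, ⟨Nat.prime_two⟩, rank3IsoRows_shaCorank_two R hR⟩

/-- The table converted has `966` rows. [cite: CremonaAlgorithms1997, Tables] -/
theorem rank3IsoRows_doors_length : rank3IsoRows.length = 966 :=
  rank3IsoRows_length

end Summit.BirchSwinnertonDyer.BirchSwinnertonDyer.Theorems.ShaPrimaryTransferIsoDoorsRank3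

end
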